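import Summits.AnomalousDissipation.AnomalousDissipation.Theorems.KolmogorovFloorEnsembleCeiling.Negative.Planar

/-!
# Negative knowledge for the crux `KolmogorovFloorEnsembleCeiling` (stmt-AnomalousDissipation-14183), III:
# the planar kill persists for the SOFT re-cut (crux idea `ceiling-slack-soft-floor`)

cdisprove seat `refuter-cdisprove-stmt-AnomalousDissipation-14183-0`, 2026-08-16. Crux idea `ceiling-slack-soft-floor`
(crux-ideate round 1, ideator 2) proposes to re-cut crux #7 by spending the ceiling as a Lagrange multiplier inside the
floor: `ε₀ ≤ D + ⟨F(u),Φ₁'(u)⟩ + 2θ₁P + λ‖u‖²` (`0 ≤ λ`, `λE < ε₀`). This file records that the negative side of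
Part II is unchanged by the re-cut: a SOFT floor family plus the ensemble ceiling still make every steady weak solution
`(ε₀ − λE)`-loud and `E`-bounded (`softFloor_ceiling_steady_loud`: the generator term and the energy channel vanish at a
steady state, `‖u‖² ≤ E` at its Dirac mass), so planar forces are excluded from the soft pair exactly as from the pair
(`not_softFloor_ceiling_planar`, from `not_loudBounded_planar`). Nothing here asserts a Theses statement.
-/

noncomputable section

set_option linter.dupNamespace false

open MeasureTheory UnitAddTorus
open scoped InnerProductSpace ENNReal

namespace Summit.AnomalousDissipation.AnomalousDissipation.Theorems.KolmogorovFloorEnsembleCeiling.Negative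

open Literature.Analysis.FunctionSpaces Literature.Analysis.FunctionSpaces.Torus Literature.Analysis.FluidPDE
open Summit.AnomalousDissipation.AnomalousDissipation.Theses.TaylorCertificates

local notation "𝕋³" => UnitAddTorus (Fin 3)
local notation "𝕋²" => UnitAddTorus (Fin 2)
local notation "E³" => EuclideanSpace ℝ (Fin 3)
local notation "E²" => EuclideanSpace ℝ (Fin 2)

/-! ## Soft floor (the re-cut `ceiling-slack-soft-floor`): the planar kill persists -/

section Soft

open Summit.AnomalousDissipation.AnomalousDissipation.Theorems.TaylorCertificatePair.Negative
open Summit.AnomalousDissipation.AnomalousDissipation.Theorems.FloorCertificate.Negative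
open Summit.AnomalousDissipation.AnomalousDissipation.Theorems.EnsembleCeiling.Negative

/-- A SOFT floor family at viscosity `ν` with slack `lam`: the floor inequality of the route with one extra summand
`lam‖u‖²` on the right (crux idea `ceiling-slack-soft-floor`, ideator 2: `ε₀ ≤ D + ⟨F,Φ₁'⟩ + 2θ₁P + λ‖u‖²`). -/
def SoftFloorFamily (f : 𝕋³ → E³) (ε₀ lam ν : ℝ) : Prop :=
  ∃ (Φ₁ : Torus.CylindricalTest (Fin 3)) (θ₁ : ℝ), θ₁ ≤ 0 ∧ ∀ u : Torus.energySpace (Fin 3),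
    Torus.eGradNormSq ((u : Lp E³ 2 (volume : Measure 𝕋³)) : 𝕋³ → E³) ≠ ⊤ →
    ‖u‖ ^ 2 ≤ 16 * (∫ x, ‖f x‖ ^ 2) / ν ^ 2 →
      ε₀ ≤ ν * (Torus.eGradNormSq ((u : Lp E³ 2 (volume : Measure 𝕋³)) : 𝕋³ → E³)).toReal +
        Torus.nsGeneratorPairing ν f u (Φ₁.grad u) +
        2 * θ₁ * (Torus.pairing (u : Lp E³ 2 (volume : Measure 𝕋³)) f -
          ν * (Torus.eGradNormSq ((u : Lp E³ 2 (volume : Measure 𝕋³)) : 𝕋³ → E³)).toReal) +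
        lam * ‖u‖ ^ 2

/-- **Soft floor + ceiling ⇒ every steady weak solution is `(ε₀ − λE)`-loud** (at a steady state `u ∈ V` the generator
term vanishes, the energy channel vanishes by the energy equation, and `‖u‖² ≤ E` by the ceiling at `δ_u`). -/
theorem softFloor_ceiling_steady_loud {f : 𝕋³ → E³} (hf : IsSmooth f) {ε₀ lam E ν : ℝ} (hν : 0 < ν) (hlam : 0 ≤ lam)
    (hfl : SoftFloorFamily f ε₀ lam ν)
    (hceil : ∀ μ : Measure (Torus.energySpace (Fin 3)), Torus.IsStationaryStatisticalSolution ν f μ →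
      Integrable (fun v : Torus.energySpace (Fin 3) => ‖v‖ ^ 2) μ → Torus.ensembleEnergy μ ≤ E)
    {u : Torus.energySpace (Fin 3)} (hV : (u : Lp E³ 2 (volume : Measure 𝕋³)) ∈ Torus.energySpaceV (Fin 3))
    (hu : Torus.IsSteadyWeakSolution ν f u) :
    ε₀ - lam * E ≤ ν * (Torus.eGradNormSq ((u : Lp E³ 2 (volume : Measure 𝕋³)) : 𝕋³ → E³)).toReal ∧ ‖u‖ ^ 2 ≤ E := by
  have hf2 : MemLp f 2 volume := hf.memLp 2
  have hbdd : ‖u‖ ^ 2 ≤ E := norm_sq_le_of_ceiling hν hf2 hceil hV hu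
  obtain ⟨Φ₁, θ₁, -, hfloor⟩ := hfl
  have hfin : Torus.eGradNormSq ((u : Lp E³ 2 (volume : Measure 𝕋³)) : 𝕋³ → E³) ≠ ⊤ := hV.2.eGradNormSq_lt_top.ne
  have henergy : ν * (Torus.eGradNormSq ((u : Lp E³ 2 (volume : Measure 𝕋³)) : 𝕋³ → E³)).toReal =
      Torus.pairing (u : Lp E³ 2 (volume : Measure 𝕋³)) f :=
    Torus.IsSteadyWeakSolution.energy_eq' (by simp) hf2 hV hu
  have hgen : Torus.nsGeneratorPairing ν f u (Φ₁.grad u) = 0 :=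
    hu _ (Torus.CylindricalTest.isSmooth_grad_holds Φ₁ u) (Torus.CylindricalTest.isDivFree_grad_holds Φ₁ u)
      (Torus.CylindricalTest.hasZeroMean_grad_holds Φ₁ u)
  have hball : ‖u‖ ^ 2 ≤ 16 * (∫ x, ‖f x‖ ^ 2) / ν ^ 2 := by
    refine ball_of_norm_le hν hf2 ?_
    have hp : Torus.pairing (u : Lp E³ 2 (volume : Measure 𝕋³)) f ≤ ‖u‖ * ‖hf2.toLp f‖ :=
      (le_abs_self _).trans (Torus.abs_pairing_coe_le hf2 u)
    have hP := Torus.norm_sq_le_toReal_eGradNormSq u hfin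
    rw [le_div_iff₀ (by positivity)]
    by_cases h0 : ‖u‖ = 0
    · rw [h0, zero_mul]; exact norm_nonneg _
    · have hpos : 0 < ‖u‖ := lt_of_le_of_ne (norm_nonneg _) (Ne.symm h0)
      have : ν * (4 * Real.pi ^ 2 * ‖u‖ ^ 2) ≤ ‖u‖ * ‖hf2.toLp f‖ := by nlinarith
      nlinarith
  have h := hfloor u hfin hball
  rw [hgen, ← henergy] at h
  have hlamE : lam * ‖u‖ ^ 2 ≤ lam * E := mul_le_mul_of_nonneg_left hbdd hlam
  refine ⟨?_, hbdd⟩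
  linarith

/-- **THE PLANAR KILL PERSISTS FOR THE SOFT RE-CUT**: for `f = (g₁,g₂,0)(x₁,x₂)` no `ε₀, E, ν₀, λ` with `0 ≤ λ`,
`λE < ε₀` carry a soft floor family AND the ensemble ceiling at every `ν < ν₀` (soft floor + ceiling make all steady
states `(ε₀ − λE)`-loud and `E`-bounded; planar forces forbid it). The Alexakis–Doering constraint on the re-cut
`KolmogorovSoftFloorEnsembleCeiling` of crux idea `ceiling-slack-soft-floor`, kernel-checked. -/
theorem not_softFloor_ceiling_planar {g : 𝕋² → E²} (hg : IsSmooth g) (hgm : HasZeroMean g) :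
    ¬ ∃ (ε₀ E ν₀ lam : ℝ), 0 < ε₀ ∧ 0 < ν₀ ∧ 0 ≤ lam ∧ lam * E < ε₀ ∧ ∀ ν : ℝ, 0 < ν → ν < ν₀ →
      SoftFloorFamily (planarLift g) ε₀ lam ν ∧
      (∀ μ : Measure (Torus.energySpace (Fin 3)), Torus.IsStationaryStatisticalSolution ν (planarLift g) μ →
        Integrable (fun v : Torus.energySpace (Fin 3) => ‖v‖ ^ 2) μ → Torus.ensembleEnergy μ ≤ E) := by
  rintro ⟨ε₀, E, ν₀, lam, hε₀, hν₀, hlam, hlamE, h⟩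
  have hε' : 0 < ε₀ - lam * E := by linarith
  refine not_loudBounded_planar (E := E) hg hgm hε' hν₀ fun ν hν hνν₀ => ?_
  intro u hu hdiv hmean hsteady
  obtain ⟨U, hU, hV, hUsteady⟩ := exists_steadyState_of_classical (isSmooth_planarLift hg) hu hdiv hmean hsteady
  obtain ⟨hloud, hbdd⟩ := softFloor_ceiling_steady_loud (isSmooth_planarLift hg) hν hlam (h ν hν hνν₀).1 (h ν hν hνν₀).2 hV hUsteady
  rw [eGradNormSq_congr_ae' hU, ← Torus.gradNormSq_eq_toReal_eGradNormSq_holds hu] at hloud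
  rw [norm_sq_of_ae hU] at hbdd
  exact ⟨hloud, hbdd⟩

end Soft

end Summit.AnomalousDissipation.AnomalousDissipation.Theorems.KolmogorovFloorEnsembleCeiling.Negative
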